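import Mathlib.Analysis.Calculus.BumpFunction.InnerProduct
import Literature.Analysis.Calculus.SmoothCutoff
import Literature.Analysis.FluidPDE.BackwardHeatGradientDoubling
import HarnessLib

/-!
# Interior gradient estimate for `C²` solutions of `|∂ₜu + Δu| ≤ c₁(|u| + |∇u|)`

Analysis/FluidPDE proof file (theorems only) in the backward-uniqueness track of **ns.S08**
(`Literature.Analysis.FluidPDE.ess_endpoint`): second step of the discharge of the named fact
`Carleman.seregin_backwardHeat_halfspace_gradient_growth` (`BackwardHeatRegularity.lean`;
Seregin 2014, App. A.3, (A.3.7), an interior estimate Seregin takes from the regularity theory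
of parabolic equations, Ladyženskaja–Solonnikov–Ural'ceva 1968). For the `C²` functions of the
vendored statement we prove the estimate directly, from the doubling-of-variables Lipschitz
bound `Carleman.gradSq_le_of_sub_le` (`BackwardHeatGradientDoubling.lean`):

* `Carleman.exists_time_cutoff`, `Carleman.exists_space_cutoff` — smooth cutoffs at scale `r`
  with the scale-invariant bounds `|χ'| ≤ C/r²`, `|∇ζ| ≤ C/r`, `|∇²ζ| ≤ C/r²`;
* `Carleman.dt_add_lap_smul_apply` — Leibniz: `(∂ₜ + Δ)(ηu) = η(∂ₜ + Δ)u + ((∂ₜ + Δ)η) u +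
  2 Σᵢ ∂ᵢη ∂ᵢu`;
* `Carleman.exists_gradSq_le_cylinder` — **localisation**: if `u` is `C²` on an open set
  containing `[t₁ - δ, t₁ + r²] × B̄(x₁, r)` (`r ≤ 1`), with `|∂ₜu + Δu| ≤ c₁(|u| + |∇u|)`,
  `|u| ≤ M`, `|∇u| ≤ G` on the future cylinder `Q_r = [t₁, t₁ + r²] × B̄(x₁, r)`, then
  `|∇u(t₁, x₁)|² ≤ C₀ M (c₁(M + G) + M/r² + G/r)` (apply the doubling bound to `w = ηu`,
  `η = χ(t)ζ(x)`; the bottom `t = t₁` needs no cutoff, the backward operator being solved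
  downwards in time);
* `Carleman.exists_sqrt_gradSq_le_of_backwardHeat` — **the interior gradient estimate**: under
  the same hypotheses with only `|u| ≤ M` on `Q_R = [t₀, t₀ + R²] × B̄(x₀, R)`, `R ≤ 1`:
  `|∇u(t₀, x₀)| ≤ C (1 + c₁) M / R` (the weighted supremum `max_Q d(z)|∇u(z)|`,
  `d = min(R - |x - x₀|, √(t₀ + R² - t))`, is attained at some `z₁`; the localised bound on the
  sub-cylinder of radius `d(z₁)/2` at `z₁`, where `|∇u| ≤ 2|∇u(z₁)|`, absorbs the gradient).

Constants depend only on `E` (through `dim E` and the fixed bump) — they are existentially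
quantified in front of all data.

## References

* G. Seregin, *Lecture notes on regularity theory for the Navier–Stokes equations*, World
  Scientific 2014, App. A.3, (A.3.7); App. A.2, Remark A.2. [Seregin2014]
* O. A. Ladyženskaja, V. A. Solonnikov, N. N. Ural'ceva, *Linear and quasi-linear equations of
  parabolic type*, AMS 1968, Chap. III §§8, 11 (interior estimates; the source Seregin cites).
-/

noncomputable section

open Set Function Filter Topology InnerProductSpace Metric
open scoped InnerProductSpace RealInnerProductSpace

namespace Literature.Analysis.FluidPDE

namespace Carleman

/-! ### Cutoffs at scale `r` -/

section Cutoff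

variable {E : Type*} [NormedAddCommGroup E] [InnerProductSpace ℝ E] [FiniteDimensional ℝ E]

/-- **Time cutoff at scale `r`**: there is `C ≥ 0` such that for all `t₁` and `r > 0` there is a
`C²` function `χ` with `χ = 1` on `(-∞, t₁ + r²/4]`, `χ = 0` on `[t₁ + r²/2, ∞)`, `|χ| ≤ 1` and
`|χ'| ≤ C / r²` (`χ(t) = S(2 - 4(t - t₁)/r²)`, `S` the smooth transition). [folklore] -/
theorem exists_time_cutoff : ∃ C : ℝ, 0 ≤ C ∧ ∀ (t₁ r : ℝ), 0 < r →
    ∃ χ : ℝ → ℝ, ContDiff ℝ 2 χ ∧ (∀ t, t ≤ t₁ + r ^ 2 / 4 → χ t = 1) ∧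
      (∀ t, t₁ + r ^ 2 / 2 ≤ t → χ t = 0) ∧ (∀ t, |χ t| ≤ 1) ∧
      ∀ t, |deriv χ t| ≤ C / r ^ 2 := by
  obtain ⟨D, hD0, hD⟩ := Calculus.exists_bound_deriv_smoothTransition
  refine ⟨4 * D, by positivity, fun t₁ r hr => ?_⟩
  have hr2 : 0 < r ^ 2 := by positivity
  have hℓ : ∀ t, HasDerivAt (fun t : ℝ => 2 - 4 * (t - t₁) / r ^ 2) (-(4 * 1 / r ^ 2)) t :=
    fun t => ((((hasDerivAt_id t).sub_const t₁).const_mul 4).div_const (r ^ 2)).const_sub 2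
  have hχ : ∀ t, HasDerivAt (fun t : ℝ => Real.smoothTransition (2 - 4 * (t - t₁) / r ^ 2))
      (deriv Real.smoothTransition (2 - 4 * (t - t₁) / r ^ 2) * (-(4 * 1 / r ^ 2))) t :=
    fun t => (Calculus.differentiable_smoothTransition _).hasDerivAt.comp t (hℓ t)
  refine ⟨fun t => Real.smoothTransition (2 - 4 * (t - t₁) / r ^ 2), ?_, ?_, ?_, ?_, ?_⟩
  · exact Real.smoothTransition.contDiff.comp (by fun_prop)
  · intro t ht
    apply Real.smoothTransition.one_of_one_le
    have : 4 * (t - t₁) / r ^ 2 ≤ 1 := by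
      rw [div_le_one hr2]
      linarith
    linarith
  · intro t ht
    apply Real.smoothTransition.zero_of_nonpos
    have : 2 ≤ 4 * (t - t₁) / r ^ 2 := by
      rw [le_div_iff₀ hr2]
      linarith
    linarith
  · intro t
    rw [abs_le]
    exact ⟨by linarith [Real.smoothTransition.nonneg (2 - 4 * (t - t₁) / r ^ 2)],
      Real.smoothTransition.le_one _⟩
  · intro t
    rw [(hχ t).deriv, abs_mul]
    have h1 := hD (2 - 4 * (t - t₁) / r ^ 2)
    have h2 : |(-(4 * 1 / r ^ 2) : ℝ)| = 4 / r ^ 2 := by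
      rw [abs_neg, mul_one, abs_of_pos (by positivity)]
    rw [h2]
    calc |deriv Real.smoothTransition (2 - 4 * (t - t₁) / r ^ 2)| * (4 / r ^ 2)
        ≤ D * (4 / r ^ 2) := mul_le_mul_of_nonneg_right h1 (by positivity)
      _ = 4 * D / r ^ 2 := by ring

/-- **Space cutoff at scale `r`**: there is `C ≥ 0` such that for all `x₁ ∈ E` and `r > 0`
there is a `C²` function `ζ` with `ζ = 1` on `B̄(x₁, r/2)`, `ζ = 0` off `B(x₁, r)`, `|ζ| ≤ 1`,
`|Dζ(y) e| ≤ (C/r)‖e‖` and `|D²ζ(y)[e, e]| ≤ (C/r²)‖e‖²` (a fixed bump rescaled,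
`ζ(y) = ζ₀(2(y - x₁)/r)`). [folklore] -/
theorem exists_space_cutoff : ∃ C : ℝ, 0 ≤ C ∧ ∀ (x₁ : E) (r : ℝ), 0 < r →
    ∃ ζ : E → ℝ, ContDiff ℝ 2 ζ ∧ (∀ y, ‖y - x₁‖ ≤ r / 2 → ζ y = 1) ∧
      (∀ y, r ≤ ‖y - x₁‖ → ζ y = 0) ∧ (∀ y, |ζ y| ≤ 1) ∧
      (∀ y e, |fderiv ℝ ζ y e| ≤ C / r * ‖e‖) ∧
      ∀ y e, |fderiv ℝ (fun y => fderiv ℝ ζ y e) y e| ≤ C / r ^ 2 * ‖e‖ ^ 2 := by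
  set ζ₀ : ContDiffBump (0 : E) := ⟨1, 2, one_pos, one_lt_two⟩ with hζ₀def
  have hζ₀ : ContDiff ℝ 2 (ζ₀ : E → ℝ) := ζ₀.contDiff
  have hζ₀' : ContDiff ℝ 1 (fderiv ℝ (ζ₀ : E → ℝ)) := hζ₀.fderiv_right (m := 1) le_rfl
  have hsupp1 : HasCompactSupport (fderiv ℝ (ζ₀ : E → ℝ)) := ζ₀.hasCompactSupport.fderiv (𝕜 := ℝ)
  obtain ⟨C₁, hC₁⟩ : ∃ C₁, ∀ w, ‖fderiv ℝ (ζ₀ : E → ℝ) w‖ ≤ C₁ :=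
    (hζ₀.continuous_fderiv (by norm_num)).bounded_above_of_compact_support hsupp1
  obtain ⟨C₂, hC₂⟩ : ∃ C₂, ∀ w, ‖fderiv ℝ (fderiv ℝ (ζ₀ : E → ℝ)) w‖ ≤ C₂ :=
    (hζ₀'.continuous_fderiv one_ne_zero).bounded_above_of_compact_support (hsupp1.fderiv (𝕜 := ℝ))
  have hC₁0 : 0 ≤ C₁ := (norm_nonneg (fderiv ℝ (ζ₀ : E → ℝ) 0)).trans (hC₁ 0)
  have hC₂0 : 0 ≤ C₂ := (norm_nonneg (fderiv ℝ (fderiv ℝ (ζ₀ : E → ℝ)) 0)).trans (hC₂ 0)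
  refine ⟨2 * C₁ + 4 * C₂, by positivity, fun x₁ r hr => ?_⟩
  set c : ℝ := 2 / r with hc
  have hc0 : 0 < c := by positivity
  set A : E → E := fun y => c • (y - x₁) with hA
  have hAd : ∀ y, HasFDerivAt A (c • ContinuousLinearMap.id ℝ E) y := fun y =>
    ((hasFDerivAt_id y).sub_const x₁).const_smul c
  have hAs : ContDiff ℝ 2 A := (contDiff_id.sub contDiff_const).const_smul c
  have hζ₀d : ∀ w, HasFDerivAt (ζ₀ : E → ℝ) (fderiv ℝ (ζ₀ : E → ℝ) w) w := fun w =>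
    ((hζ₀.differentiable (by norm_num)) w).hasFDerivAt
  -- first derivative of the rescaled bump
  have hd1 : ∀ y e, fderiv ℝ (fun y => ζ₀ (A y)) y e = c * fderiv ℝ (ζ₀ : E → ℝ) (A y) e := by
    intro y e
    have h : HasFDerivAt (fun y => ζ₀ (A y))
        ((fderiv ℝ (ζ₀ : E → ℝ) (A y)).comp (c • ContinuousLinearMap.id ℝ E)) y :=
      (hζ₀d (A y)).comp y (hAd y)
    rw [h.fderiv]
    simp [smul_eq_mul]
  -- the partial derivative `y ↦ D(ζ₀ ∘ A)(y) e` and its derivative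
  have hG : ∀ e, Differentiable ℝ fun w => fderiv ℝ (ζ₀ : E → ℝ) w e := fun e =>
    (hζ₀'.differentiable one_ne_zero).clm_apply (differentiable_const e)
  have hd2 : ∀ y e, fderiv ℝ (fun y => fderiv ℝ (fun y => ζ₀ (A y)) y e) y e =
      c * c * fderiv ℝ (fderiv ℝ (ζ₀ : E → ℝ)) (A y) e e := by
    intro y e
    have hfun : (fun y => fderiv ℝ (fun y => ζ₀ (A y)) y e) =
        fun y => c * fderiv ℝ (ζ₀ : E → ℝ) (A y) e := funext fun y => hd1 y e
    rw [hfun]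
    have h2 : HasFDerivAt (fun y => c * fderiv ℝ (ζ₀ : E → ℝ) (A y) e)
        (c • ((fderiv ℝ (fun w => fderiv ℝ (ζ₀ : E → ℝ) w e) (A y)).comp
          (c • ContinuousLinearMap.id ℝ E))) y :=
      (((hG e) (A y)).hasFDerivAt.comp y (hAd y)).const_mul c
    rw [h2.fderiv]
    have h3 : fderiv ℝ (fun w => fderiv ℝ (ζ₀ : E → ℝ) w e) (A y) e =
        fderiv ℝ (fderiv ℝ (ζ₀ : E → ℝ)) (A y) e e := by
      rw [fderiv_clm_apply ((hζ₀'.differentiable one_ne_zero) (A y)) (differentiableAt_const e)]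
      simp
    simp [h3, smul_eq_mul]
    ring
  refine ⟨fun y => ζ₀ (A y), ?_, ?_, ?_, ?_, ?_, ?_⟩
  · exact hζ₀.comp hAs
  · intro y hy
    apply ζ₀.one_of_mem_closedBall
    rw [mem_closedBall, dist_zero_right, hA]
    simp only [norm_smul, Real.norm_eq_abs, abs_of_pos hc0]
    calc c * ‖y - x₁‖ ≤ c * (r / 2) := mul_le_mul_of_nonneg_left hy hc0.le
      _ = 1 := by rw [hc]; field_simp
  · intro y hy
    apply ζ₀.zero_of_le_dist
    rw [dist_zero_right, hA]
    simp only [norm_smul, Real.norm_eq_abs, abs_of_pos hc0]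
    calc (2 : ℝ) = c * r := by rw [hc]; field_simp
      _ ≤ c * ‖y - x₁‖ := mul_le_mul_of_nonneg_left hy hc0.le
  · intro y
    rw [abs_le]
    exact ⟨by linarith [ζ₀.nonneg' (A y)], ζ₀.le_one⟩
  · intro y e
    rw [hd1, abs_mul, abs_of_pos hc0]
    have h1 : |fderiv ℝ (ζ₀ : E → ℝ) (A y) e| ≤ C₁ * ‖e‖ := by
      rw [← Real.norm_eq_abs]
      exact (ContinuousLinearMap.le_opNorm _ _).trans (mul_le_mul_of_nonneg_right (hC₁ _) (norm_nonneg _))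
    calc c * |fderiv ℝ (ζ₀ : E → ℝ) (A y) e| ≤ c * (C₁ * ‖e‖) := mul_le_mul_of_nonneg_left h1 hc0.le
      _ = 2 * C₁ / r * ‖e‖ := by rw [hc]; ring
      _ ≤ (2 * C₁ + 4 * C₂) / r * ‖e‖ := by
          refine mul_le_mul_of_nonneg_right (div_le_div_of_nonneg_right (by linarith) hr.le) (norm_nonneg _)
  · intro y e
    rw [hd2, abs_mul, show |c * c| = c * c from abs_of_pos (by positivity)]
    have h1 : |fderiv ℝ (fderiv ℝ (ζ₀ : E → ℝ)) (A y) e e| ≤ C₂ * ‖e‖ ^ 2 := by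
      rw [← Real.norm_eq_abs]
      calc ‖fderiv ℝ (fderiv ℝ (ζ₀ : E → ℝ)) (A y) e e‖
          ≤ ‖fderiv ℝ (fderiv ℝ (ζ₀ : E → ℝ)) (A y) e‖ * ‖e‖ := ContinuousLinearMap.le_opNorm _ _
        _ ≤ ‖fderiv ℝ (fderiv ℝ (ζ₀ : E → ℝ)) (A y)‖ * ‖e‖ * ‖e‖ :=
            mul_le_mul_of_nonneg_right (ContinuousLinearMap.le_opNorm _ _) (norm_nonneg _)
        _ ≤ C₂ * ‖e‖ * ‖e‖ := by gcongr; exact hC₂ _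
        _ = C₂ * ‖e‖ ^ 2 := by ring
    calc c * c * |fderiv ℝ (fderiv ℝ (ζ₀ : E → ℝ)) (A y) e e| ≤ c * c * (C₂ * ‖e‖ ^ 2) :=
          mul_le_mul_of_nonneg_left h1 (by positivity)
      _ = 4 * C₂ / r ^ 2 * ‖e‖ ^ 2 := by rw [hc]; field_simp; ring
      _ ≤ (2 * C₁ + 4 * C₂) / r ^ 2 * ‖e‖ ^ 2 := by
          refine mul_le_mul_of_nonneg_right
            (div_le_div_of_nonneg_right (by linarith) (by positivity)) (by positivity)

omit [FiniteDimensional ℝ E] in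
/-- The derivative of a separated product `(t, y) ↦ A(t) B(y)`:
`D(AB)(t, y)(a, e) = a A'(t) B(y) + A(t) DB(y) e`. [folklore] -/
theorem fderiv_mul_fst_snd_apply {A : ℝ → ℝ} {B : E → ℝ} (hA : Differentiable ℝ A)
    (hB : Differentiable ℝ B) (t : ℝ) (y : E) (a : ℝ) (e : E) :
    fderiv ℝ (fun z : ℝ × E => A z.1 * B z.2) (t, y) (a, e) =
      a * deriv A t * B y + A t * fderiv ℝ B y e := by
  have h1 : HasFDerivAt (fun z : ℝ × E => A z.1)
      ((ContinuousLinearMap.smulRight (1 : ℝ →L[ℝ] ℝ) (deriv A t)).comp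
        (ContinuousLinearMap.fst ℝ ℝ E)) (t, y) :=
    (hA t).hasDerivAt.hasFDerivAt.comp (t, y) hasFDerivAt_fst
  have h2 : HasFDerivAt (fun z : ℝ × E => B z.2)
      ((fderiv ℝ B y).comp (ContinuousLinearMap.snd ℝ ℝ E)) (t, y) :=
    (hB y).hasFDerivAt.comp (t, y) hasFDerivAt_snd
  rw [(h1.fun_mul h2).fderiv]
  simp
  ring

end Cutoff

/-! ### Leibniz rule for `(∂ₜ + Δ)(η u)` -/

section Leibniz

variable {E : Type*} [NormedAddCommGroup E] [InnerProductSpace ℝ E] [FiniteDimensional ℝ E]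
variable {F : Type*} [NormedAddCommGroup F] [NormedSpace ℝ F]

/-- **Leibniz rule**: at a point of an open set where `u` is `C²`, for `η ∈ C²(ℝ × E)`,
`(∂ₜ + Δ)(ηu) = η (∂ₜ + Δ)u + ((∂ₜ + Δ)η) u + 2 Σᵢ ∂ᵢη ∂ᵢu`. [folklore] -/
theorem dt_add_lap_smul_apply {η : ℝ × E → ℝ} {u : ℝ × E → F} {U : Set (ℝ × E)}
    (hU : IsOpen U) (hη : ContDiff ℝ 2 η) (hu : ContDiffOn ℝ 2 u U) {z : ℝ × E} (hz : z ∈ U) :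
    dt (fun z => η z • u z) z + lap (fun z => η z • u z) z =
      η z • (dt u z + lap u z) + (dt η z + lap η z) • u z +
        (2 : ℝ) • ∑ i, dx (stdOrthonormalBasis ℝ E i) η z • dx (stdOrthonormalBasis ℝ E i) u z := by
  set b := stdOrthonormalBasis ℝ E with hb
  have hηd : ∀ z, DifferentiableAt ℝ η z := fun z => (hη.differentiable (by norm_num)) z
  have hud : ∀ z' ∈ U, DifferentiableAt ℝ u z' := fun z' hz' =>
    (hu.differentiableOn (by norm_num)).differentiableAt (hU.mem_nhds hz')
  -- first derivatives of the product on `U`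
  have h1 : ∀ z' ∈ U, ∀ d, fderiv ℝ (fun z => η z • u z) z' d =
      η z' • fderiv ℝ u z' d + fderiv ℝ η z' d • u z' := by
    intro z' hz' d
    rw [fderiv_fun_smul (hηd z') (hud z' hz')]
    simp
  -- differentiability of the frame derivatives at `z`
  have hdxu : ∀ e : E, DifferentiableAt ℝ (dx e u) z := fun e => by
    have hc : ContDiffOn ℝ 1 (fun z' => fderiv ℝ u z' (0, e)) U :=
      (hu.fderiv_of_isOpen hU le_rfl).clm_apply contDiffOn_const
    exact (hc.differentiableOn one_ne_zero).differentiableAt (hU.mem_nhds hz)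
  have hdxη : ∀ e : E, DifferentiableAt ℝ (dx e η) z := fun e => by
    have hc : ContDiff ℝ 1 fun z' => fderiv ℝ η z' (0, e) :=
      (hη.fderiv_right (m := 1) le_rfl).clm_apply contDiff_const
    exact (hc.differentiable one_ne_zero) z
  -- second frame derivatives of the product
  have h2 : ∀ e : E, dx e (dx e fun z => η z • u z) z =
      η z • dx e (dx e u) z + (2 : ℝ) • (dx e η z • dx e u z) + dx e (dx e η) z • u z := by
    intro e
    have hev : dx e (fun z => η z • u z) =ᶠ[𝓝 z] fun z' => η z' • dx e u z' + dx e η z' • u z' := by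
      filter_upwards [hU.mem_nhds hz] with z' hz'
      simp only [dx_apply]
      exact h1 z' hz' _
    rw [dx_apply, hev.fderiv_eq,
      fderiv_fun_add ((hηd z).fun_smul (hdxu e)) ((hdxη e).fun_smul (hud z hz)),
      fderiv_fun_smul (hηd z) (hdxu e), fderiv_fun_smul (hdxη e) (hud z hz)]
    simp only [add_apply, FunLike.coe_smul, Pi.smul_apply,
      ContinuousLinearMap.smulRight_apply, two_smul, dx_apply]
    abel
  have hdt : dt (fun z => η z • u z) z = η z • dt u z + dt η z • u z := by
    simp only [dt_apply]
    exact h1 z hz _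
  rw [hdt]
  simp only [lap]
  rw [Finset.sum_congr rfl fun i _ => h2 (b i), Finset.sum_add_distrib, Finset.sum_add_distrib,
    ← Finset.smul_sum, ← Finset.smul_sum, ← Finset.sum_smul, smul_add, add_smul]
  abel

end Leibniz

/-! ### Localisation: the gradient at the bottom centre of a future cylinder -/

section Localisation

variable (E : Type*) [NormedAddCommGroup E] [InnerProductSpace ℝ E] [FiniteDimensional ℝ E]
variable (F : Type*) [NormedAddCommGroup F] [InnerProductSpace ℝ F]

/-- **Localised gradient bound.** There is `C₀ = C₀(E) > 0` such that: if `u : ℝ × E → F` is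
`C²` on an open set containing `[t₁ - δ, t₁ + r²] × B̄(x₁, r)` (`0 < r ≤ 1`, `δ > 0`), and on the
future cylinder `Q_r = [t₁, t₁ + r²] × B̄(x₁, r)` one has `|∂ₜu + Δu| ≤ c₁(|u| + |∇u|)`,
`|u| ≤ M` and `|∇u| ≤ G`, then `|∇u(t₁, x₁)|² ≤ C₀ M (c₁(M + G) + M/r² + G/r)`. [folklore] -/
theorem exists_gradSq_le_cylinder : ∃ C₀ : ℝ, 0 < C₀ ∧
    ∀ ⦃u : ℝ × E → F⦄ ⦃U : Set (ℝ × E)⦄ ⦃c₁ t₁ : ℝ⦄ ⦃x₁ : E⦄ ⦃r δ M G : ℝ⦄,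
      IsOpen U → 0 < r → r ≤ 1 → 0 < δ → 0 ≤ c₁ → 0 ≤ M → 0 ≤ G →
      Icc (t₁ - δ) (t₁ + r ^ 2) ×ˢ closedBall x₁ r ⊆ U → ContDiffOn ℝ 2 u U →
      (∀ z ∈ Icc t₁ (t₁ + r ^ 2) ×ˢ closedBall x₁ r,
        ‖dt u z + lap u z‖ ≤ c₁ * (‖u z‖ + Real.sqrt (gradSq u z))) →
      (∀ z ∈ Icc t₁ (t₁ + r ^ 2) ×ˢ closedBall x₁ r, ‖u z‖ ≤ M) →
      (∀ z ∈ Icc t₁ (t₁ + r ^ 2) ×ˢ closedBall x₁ r, Real.sqrt (gradSq u z) ≤ G) →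
      gradSq u (t₁, x₁) ≤ C₀ * M * (c₁ * (M + G) + M / r ^ 2 + G / r) := by
  obtain ⟨Ct, hCt0, hχ⟩ := exists_time_cutoff
  obtain ⟨Cs, hCs0, hζ⟩ := exists_space_cutoff (E := E)
  set n : ℕ := Module.finrank ℝ E with hn
  set b := stdOrthonormalBasis ℝ E with hb
  -- a constant dominating all coefficients
  set K₁ : ℝ := 1 + Ct + n * Cs + 2 * n * Cs with hK₁
  have hK₁1 : 1 ≤ K₁ := by
    have : (0 : ℝ) ≤ n := Nat.cast_nonneg _
    rw [hK₁]; nlinarith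
  refine ⟨2 * n * K₁ + 1, by positivity, ?_⟩
  intro u U c₁ t₁ x₁ r δ M G hU hr hr1 hδ hc₁ hM hG hsubU hu hineq hMb hGb
  obtain ⟨χ, hχs, hχ1, hχ0, hχb, hχd⟩ := hχ t₁ r hr
  obtain ⟨ζ, hζs, hζ1, hζ0, hζb, hζd1, hζd2⟩ := hζ x₁ r hr
  have hχdiff : Differentiable ℝ χ := hχs.differentiable (by norm_num)
  have hζdiff : Differentiable ℝ ζ := hζs.differentiable (by norm_num)
  have hζ' : ∀ e, Differentiable ℝ fun y => fderiv ℝ ζ y e := fun e =>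
    ((hζs.fderiv_right (m := 1) le_rfl).differentiable one_ne_zero).clm_apply
      (differentiable_const e)
  -- the cutoff `η = χ(t) ζ(x)` and `w = η u`
  set η : ℝ × E → ℝ := fun z => χ z.1 * ζ z.2 with hη
  set w : ℝ × E → F := fun z => η z • u z with hw
  have hηs : ContDiff ℝ 2 η := (hχs.comp contDiff_fst).mul (hζs.comp contDiff_snd)
  have hη_le : ∀ z, |η z| ≤ 1 := fun z => by
    rw [hη, abs_mul]
    exact mul_le_one₀ (hχb _) (abs_nonneg _) (hζb _)
  -- frame derivatives of `η`
  have hdtη : ∀ t y, dt η (t, y) = deriv χ t * ζ y := by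
    intro t y
    rw [dt_apply, hη, fderiv_mul_fst_snd_apply hχdiff hζdiff]
    simp
  have hdxη : ∀ (e : E) (z : ℝ × E), dx e η z = χ z.1 * fderiv ℝ ζ z.2 e := by
    intro e z
    obtain ⟨t, y⟩ := z
    rw [dx_apply, hη, fderiv_mul_fst_snd_apply hχdiff hζdiff]
    simp
  have hdxdxη : ∀ (e : E) (t : ℝ) (y : E),
      dx e (dx e η) (t, y) = χ t * fderiv ℝ (fun y => fderiv ℝ ζ y e) y e := by
    intro e t y
    have hfun : dx e η = fun z => χ z.1 * (fun y => fderiv ℝ ζ y e) z.2 := funext (hdxη e)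
    rw [dx_apply, hfun, fderiv_mul_fst_snd_apply hχdiff (hζ' e)]
    simp
  -- bounds on them
  have hdtη_le : ∀ z, |dt η z| ≤ Ct / r ^ 2 := by
    rintro ⟨t, y⟩
    rw [hdtη, abs_mul]
    calc |deriv χ t| * |ζ y| ≤ Ct / r ^ 2 * 1 :=
          mul_le_mul (hχd t) (hζb y) (abs_nonneg _) (by positivity)
      _ = Ct / r ^ 2 := mul_one _
  have hdxη_le : ∀ i z, |dx (b i) η z| ≤ Cs / r := by
    intro i z
    rw [hdxη, abs_mul]
    calc |χ z.1| * |fderiv ℝ ζ z.2 (b i)| ≤ 1 * (Cs / r * ‖b i‖) :=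
          mul_le_mul (hχb _) (hζd1 _ _) (abs_nonneg _) zero_le_one
      _ = Cs / r := by rw [b.orthonormal.1 i]; ring
  have hlapη_le : ∀ z, |lap η z| ≤ n * (Cs / r ^ 2) := by
    rintro ⟨t, y⟩
    simp only [lap]
    calc |∑ i, dx (b i) (dx (b i) η) (t, y)| ≤ ∑ i, |dx (b i) (dx (b i) η) (t, y)| :=
          Finset.abs_sum_le_sum_abs _ _
      _ ≤ ∑ _i : Fin (Module.finrank ℝ E), Cs / r ^ 2 := by
          refine Finset.sum_le_sum fun i _ => ?_
          rw [hdxdxη, abs_mul]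
          calc |χ t| * |fderiv ℝ (fun y => fderiv ℝ ζ y (b i)) y (b i)|
              ≤ 1 * (Cs / r ^ 2 * ‖b i‖ ^ 2) :=
                mul_le_mul (hχb _) (hζd2 _ _) (abs_nonneg _) zero_le_one
            _ = Cs / r ^ 2 := by rw [b.orthonormal.1 i]; ring
      _ = n * (Cs / r ^ 2) := by simp [hn]
  -- support of `η`
  have hηsupp : tsupport η ⊆ Iic (t₁ + r ^ 2 / 2) ×ˢ closedBall x₁ r := by
    refine closure_minimal (fun z hz => ?_) (isClosed_Iic.prod isClosed_closedBall)
    rw [mem_support] at hz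
    refine ⟨?_, ?_⟩
    · by_contra h
      refine hz ?_
      simp only [mem_Iic, not_le] at h
      simp [hη, hχ0 z.1 h.le]
    · by_contra h
      refine hz ?_
      simp only [mem_closedBall, dist_eq_norm, not_le] at h
      simp [hη, hζ0 z.2 h.le]
  have hQU : Icc t₁ (t₁ + r ^ 2) ×ˢ closedBall x₁ r ⊆ U := fun z hz =>
    hsubU ⟨⟨by linarith [hz.1.1], hz.1.2⟩, hz.2⟩
  have hsuppQ : ∀ z ∈ tsupport η, t₁ ≤ z.1 → z ∈ Icc t₁ (t₁ + r ^ 2) ×ˢ closedBall x₁ r := by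
    intro z hz ht
    have h := hηsupp hz
    exact ⟨⟨ht, (mem_Iic.1 h.1).trans (by nlinarith)⟩, h.2⟩
  -- `w` is `C²` on `V = (t₁ - δ, ∞) × E`
  set V : Set (ℝ × E) := Ioi (t₁ - δ) ×ˢ univ with hV
  have hVo : IsOpen V := isOpen_Ioi.prod isOpen_univ
  have hVsub : Ici t₁ ×ˢ (univ : Set E) ⊆ V := fun z hz =>
    ⟨lt_of_lt_of_le (by linarith) (mem_Ici.1 hz.1), mem_univ _⟩
  have hwV : ContDiffOn ℝ 2 w V := by
    intro z hz
    by_cases hzs : z ∈ tsupport η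
    · have h := hηsupp hzs
      have hzU : z ∈ U :=
        hsubU ⟨⟨le_of_lt hz.1, (mem_Iic.1 h.1).trans (by nlinarith)⟩, h.2⟩
      exact (hηs.contDiffAt.smul (hu.contDiffAt (hU.mem_nhds hzU))).contDiffWithinAt
    · have h0 : w =ᶠ[𝓝 z] fun _ => 0 := by
        filter_upwards [notMem_tsupport_iff_eventuallyEq.1 hzs] with z' hz'
        simp [hw, hz']
      exact ((contDiffAt_const (c := (0 : F))).congr_of_eventuallyEq h0).contDiffWithinAt
  -- vanishing of `w`
  have hwT : ∀ t x, t₁ + r ^ 2 / 2 ≤ t → w (t, x) = 0 := fun t x ht => by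
    simp [hw, hη, hχ0 t ht]
  have hwR : ∀ t x, ‖x₁‖ + r ≤ ‖x‖ → w (t, x) = 0 := fun t x hx => by
    have : r ≤ ‖x - x₁‖ := by
      have := norm_sub_norm_le x x₁
      linarith
    simp [hw, hη, hζ0 x this]
  -- `‖w‖ ≤ M` for `t ≥ t₁`
  have hwM : ∀ t x, t₁ ≤ t → ‖w (t, x)‖ ≤ M := by
    intro t x ht
    by_cases hzs : (t, x) ∈ tsupport η
    · have hzQ := hsuppQ _ hzs ht
      simp only [hw, norm_smul, Real.norm_eq_abs]
      calc |η (t, x)| * ‖u (t, x)‖ ≤ 1 * M :=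
            mul_le_mul (hη_le _) (hMb _ hzQ) (norm_nonneg _) zero_le_one
        _ = M := one_mul M
    · have : w (t, x) = 0 :=
        image_eq_zero_of_notMem_tsupport fun h => hzs (tsupport_smul_subset_left η u h)
      rw [this, norm_zero]
      exact hM
  -- `‖∂ₜw + Δw‖ ≤ N` for `t ≥ t₁`
  set N : ℝ := c₁ * (M + G) + (Ct / r ^ 2 + n * (Cs / r ^ 2)) * M + 2 * (n * (Cs / r) * G)
    with hN
  have hN0 : 0 ≤ N := by positivity
  have hwN : ∀ t x, t₁ ≤ t → ‖dt w (t, x) + lap w (t, x)‖ ≤ N := by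
    intro t x ht
    by_cases hzs : (t, x) ∈ tsupport η
    · have hzQ := hsuppQ _ hzs ht
      have hzU := hQU hzQ
      rw [hw, dt_add_lap_smul_apply hU hηs hu hzU]
      have e1 : ‖η (t, x) • (dt u (t, x) + lap u (t, x))‖ ≤ c₁ * (M + G) := by
        rw [norm_smul, Real.norm_eq_abs]
        calc |η (t, x)| * ‖dt u (t, x) + lap u (t, x)‖
            ≤ 1 * (c₁ * (‖u (t, x)‖ + Real.sqrt (gradSq u (t, x)))) :=
              mul_le_mul (hη_le _) (hineq _ hzQ) (norm_nonneg _) zero_le_one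
          _ ≤ c₁ * (M + G) := by
              rw [one_mul]
              exact mul_le_mul_of_nonneg_left (add_le_add (hMb _ hzQ) (hGb _ hzQ)) hc₁
      have e2 : ‖(dt η (t, x) + lap η (t, x)) • u (t, x)‖ ≤ (Ct / r ^ 2 + n * (Cs / r ^ 2)) * M := by
        rw [norm_smul, Real.norm_eq_abs]
        exact mul_le_mul ((abs_add_le _ _).trans (add_le_add (hdtη_le _) (hlapη_le _))) (hMb _ hzQ)
          (norm_nonneg _) (by positivity)
      have e3 : ‖(2 : ℝ) • ∑ i, dx (b i) η (t, x) • dx (b i) u (t, x)‖ ≤ 2 * (n * (Cs / r) * G) := by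
        rw [norm_smul, Real.norm_eq_abs, abs_two]
        refine mul_le_mul_of_nonneg_left ?_ zero_le_two
        calc ‖∑ i, dx (b i) η (t, x) • dx (b i) u (t, x)‖
            ≤ ∑ i, ‖dx (b i) η (t, x) • dx (b i) u (t, x)‖ := norm_sum_le _ _
          _ ≤ ∑ _i : Fin (Module.finrank ℝ E), Cs / r * G := by
              refine Finset.sum_le_sum fun i _ => ?_
              rw [norm_smul, Real.norm_eq_abs]
              refine mul_le_mul (hdxη_le i _) ?_ (norm_nonneg _) (by positivity)
              -- a single frame derivative is bounded by `√(gradSq)`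
              have hi : ‖dx (b i) u (t, x)‖ ^ 2 ≤ gradSq u (t, x) := by
                rw [gradSq]
                exact Finset.single_le_sum (f := fun j => ‖dx (b j) u (t, x)‖ ^ 2)
                  (fun j _ => sq_nonneg _) (Finset.mem_univ i)
              calc ‖dx (b i) u (t, x)‖ = Real.sqrt (‖dx (b i) u (t, x)‖ ^ 2) :=
                    (Real.sqrt_sq (norm_nonneg _)).symm
                _ ≤ Real.sqrt (gradSq u (t, x)) := Real.sqrt_le_sqrt hi
                _ ≤ G := hGb _ hzQ
          _ = n * (Cs / r) * G := by simp [hn]; ring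
      calc _ ≤ ‖η (t, x) • (dt u (t, x) + lap u (t, x))‖ + ‖(dt η (t, x) + lap η (t, x)) • u (t, x)‖ +
            ‖(2 : ℝ) • ∑ i, dx (b i) η (t, x) • dx (b i) u (t, x)‖ := norm_add₃_le
        _ ≤ N := by rw [hN]; exact add_le_add (add_le_add e1 e2) e3
    · have hzw : (t, x) ∉ tsupport w := fun h => hzs (tsupport_smul_subset_left η u h)
      have h1 : dt w (t, x) = 0 :=
        image_eq_zero_of_notMem_tsupport fun h => hzw (tsupport_dt_subset w h)
      have h2 : lap w (t, x) = 0 :=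
        image_eq_zero_of_notMem_tsupport fun h => hzw (tsupport_lap_subset w h)
      rw [h1, h2, add_zero, norm_zero]
      exact hN0
  -- the doubling bound for `w`
  have hgrad := gradSq_le_of_sub_le hVo hVsub hwV hwT hwR hwM hwN t₁ x₁ le_rfl
  -- `w = u` near `(t₁, x₁)`
  have heq : gradSq w (t₁, x₁) = gradSq u (t₁, x₁) := by
    have hev : w =ᶠ[𝓝 (t₁, x₁)] u := by
      have ho : IsOpen (Iio (t₁ + r ^ 2 / 4) ×ˢ ball x₁ (r / 2)) := isOpen_Iio.prod isOpen_ball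
      have hmem : (t₁, x₁) ∈ Iio (t₁ + r ^ 2 / 4) ×ˢ ball x₁ (r / 2) :=
        ⟨by simp only [mem_Iio]; nlinarith, mem_ball_self (by positivity)⟩
      filter_upwards [ho.mem_nhds hmem] with z hz
      have h1 : χ z.1 = 1 := hχ1 z.1 (le_of_lt hz.1)
      have h2 : ζ z.2 = 1 := hζ1 z.2 (by
        have := hz.2; rw [mem_ball, dist_eq_norm] at this; exact this.le)
      simp [hw, hη, h1, h2]
    simp only [gradSq, dx_apply, hev.fderiv_eq]
  rw [← heq]
  refine hgrad.trans ?_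
  -- `n · 2NM ≤ (2nK₁ + 1) M (c₁(M + G) + M/r² + G/r)`
  have hS0 : 0 ≤ c₁ * (M + G) + M / r ^ 2 + G / r := by positivity
  have hNle : N ≤ K₁ * (c₁ * (M + G) + M / r ^ 2 + G / r) := by
    rw [hN]
    have h1 : c₁ * (M + G) ≤ K₁ * (c₁ * (M + G)) :=
      le_mul_of_one_le_left (by positivity) hK₁1
    have h2 : (Ct / r ^ 2 + n * (Cs / r ^ 2)) * M ≤ K₁ * (M / r ^ 2) := by
      rw [show (Ct / r ^ 2 + n * (Cs / r ^ 2)) * M = (Ct + n * Cs) * (M / r ^ 2) by ring]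
      refine mul_le_mul_of_nonneg_right ?_ (by positivity)
      rw [hK₁]
      have : (0 : ℝ) ≤ n * Cs := by positivity
      linarith
    have h3 : 2 * (n * (Cs / r) * G) ≤ K₁ * (G / r) := by
      rw [show 2 * (n * (Cs / r) * G) = (2 * n * Cs) * (G / r) by ring]
      refine mul_le_mul_of_nonneg_right ?_ (by positivity)
      rw [hK₁]
      have : (0 : ℝ) ≤ n * Cs := by positivity
      linarith
    nlinarith
  have hn0 : (0 : ℝ) ≤ n := Nat.cast_nonneg _
  calc (n : ℝ) * (2 * N * M) = 2 * n * M * N := by ring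
    _ ≤ 2 * n * M * (K₁ * (c₁ * (M + G) + M / r ^ 2 + G / r)) :=
        mul_le_mul_of_nonneg_left hNle (by positivity)
    _ = 2 * n * K₁ * M * (c₁ * (M + G) + M / r ^ 2 + G / r) := by ring
    _ ≤ (2 * n * K₁ + 1) * M * (c₁ * (M + G) + M / r ^ 2 + G / r) := by
        have : 0 ≤ M * (c₁ * (M + G) + M / r ^ 2 + G / r) := mul_nonneg hM hS0
        nlinarith

/-- Elementary absorption: `g² ≤ 2s²Xg + s²X²` with `g, X, s ≥ 0` forces `g ≤ (2s² + s)X`.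
[folklore] -/
theorem le_of_sq_le_two_mul_add {g X s : ℝ} (hX : 0 ≤ X) (hs : 0 ≤ s)
    (h : g ^ 2 ≤ 2 * s ^ 2 * X * g + s ^ 2 * X ^ 2) : g ≤ (2 * s ^ 2 + s) * X := by
  have h0 : 0 ≤ s ^ 3 * X ^ 2 := by positivity
  have h1 : (g - s ^ 2 * X) ^ 2 ≤ (s * X * (1 + s)) ^ 2 := by nlinarith
  have h2 : |g - s ^ 2 * X| ≤ |s * X * (1 + s)| := sq_le_sq.1 h1
  rw [abs_of_nonneg (by positivity : 0 ≤ s * X * (1 + s))] at h2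
  have h3 := (le_abs_self _).trans h2
  nlinarith

/-- Elementary arithmetic for the absorption step (`q = 1/ρ ≥ 1`). [folklore] -/
theorem localisation_arith {c₁ M g q : ℝ} (hc₁ : 0 ≤ c₁) (hM : 0 ≤ M) (hg : 0 ≤ g)
    (hq : 1 ≤ q) :
    M * (c₁ * (M + 2 * g) + M * q ^ 2 + 2 * g * q) ≤
      2 * ((1 + c₁) * M * q) * g + ((1 + c₁) * M * q) ^ 2 := by
  have h1 : c₁ * M ^ 2 ≤ c₁ * M ^ 2 * q ^ 2 := by
    have hq2 : 1 ≤ q ^ 2 := one_le_pow₀ hq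
    have h0 : 0 ≤ c₁ * M ^ 2 := by positivity
    calc c₁ * M ^ 2 = c₁ * M ^ 2 * 1 := (mul_one _).symm
      _ ≤ c₁ * M ^ 2 * q ^ 2 := mul_le_mul_of_nonneg_left hq2 h0
  have h2 : 2 * c₁ * M * g ≤ 2 * c₁ * M * q * g := by
    have h0 : 0 ≤ 2 * c₁ * M * g := by positivity
    calc 2 * c₁ * M * g = 2 * c₁ * M * g * 1 := (mul_one _).symm
      _ ≤ 2 * c₁ * M * g * q := mul_le_mul_of_nonneg_left hq h0
      _ = 2 * c₁ * M * q * g := by ring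
  have h3 : 0 ≤ c₁ * M ^ 2 * q ^ 2 := by
    have : 0 ≤ q ^ 2 := sq_nonneg q
    positivity
  have h4 : 0 ≤ c₁ ^ 2 * M ^ 2 * q ^ 2 := by positivity
  have key : 2 * ((1 + c₁) * M * q) * g + ((1 + c₁) * M * q) ^ 2 -
      M * (c₁ * (M + 2 * g) + M * q ^ 2 + 2 * g * q) =
      (c₁ * M ^ 2 * q ^ 2 - c₁ * M ^ 2) + c₁ * M ^ 2 * q ^ 2 +
        (2 * c₁ * M * q * g - 2 * c₁ * M * g) + c₁ ^ 2 * M ^ 2 * q ^ 2 := by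
    ring
  linarith [key, h1, h2, h3, h4]

/-- **Interior gradient estimate for the backward heat inequality** (the `C²` case of the
estimate Seregin 2014 takes from the regularity theory of parabolic equations in Remark A.2 and
(A.3.7)). There is `C = C(E) > 0` such that: if `u : ℝ × E → F` is `C²` on an open set
containing `[t₀ - δ, t₀ + R²] × B̄(x₀, R)` (`0 < R ≤ 1`, `δ > 0`) and on the future cylinder
`Q_R = [t₀, t₀ + R²] × B̄(x₀, R)` one has `|∂ₜu + Δu| ≤ c₁(|u| + |∇u|)` (`c₁ ≥ 0`) and
`|u| ≤ M`, then `|∇u(t₀, x₀)| ≤ C (1 + c₁) M / R`. [cite: Seregin2014, App. A.2 Remark A.2 and App. A.3 (A.3.7)] -/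
theorem exists_sqrt_gradSq_le_of_backwardHeat : ∃ C : ℝ, 0 < C ∧
    ∀ ⦃u : ℝ × E → F⦄ ⦃U : Set (ℝ × E)⦄ ⦃c₁ t₀ : ℝ⦄ ⦃x₀ : E⦄ ⦃R δ M : ℝ⦄,
      IsOpen U → 0 < R → R ≤ 1 → 0 < δ → 0 ≤ c₁ → 0 ≤ M →
      Icc (t₀ - δ) (t₀ + R ^ 2) ×ˢ closedBall x₀ R ⊆ U → ContDiffOn ℝ 2 u U →
      (∀ z ∈ Icc t₀ (t₀ + R ^ 2) ×ˢ closedBall x₀ R,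
        ‖dt u z + lap u z‖ ≤ c₁ * (‖u z‖ + Real.sqrt (gradSq u z))) →
      (∀ z ∈ Icc t₀ (t₀ + R ^ 2) ×ˢ closedBall x₀ R, ‖u z‖ ≤ M) →
      Real.sqrt (gradSq u (t₀, x₀)) ≤ C * (1 + c₁) * M / R := by
  obtain ⟨C₀, hC₀, hB⟩ := exists_gradSq_le_cylinder E F
  set s : ℝ := Real.sqrt C₀ with hs
  have hs0 : 0 ≤ s := Real.sqrt_nonneg _
  have hs2 : s ^ 2 = C₀ := Real.sq_sqrt hC₀.le
  set K₀ : ℝ := 2 * s ^ 2 + s with hK₀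
  have hK₀0 : 0 < K₀ := by rw [hK₀, hs2]; positivity
  refine ⟨2 * K₀, by positivity, ?_⟩
  intro u U c₁ t₀ x₀ R δ M hU hR hR1 hδ hc₁ hM hsubU hu hineq hMb
  set Q : Set (ℝ × E) := Icc t₀ (t₀ + R ^ 2) ×ˢ closedBall x₀ R with hQ
  have hQU : Q ⊆ U := fun z hz => hsubU ⟨⟨by linarith [hz.1.1], hz.1.2⟩, hz.2⟩
  -- the weight `d` and the weighted gradient `Φ`
  set d : ℝ × E → ℝ := fun z => min (R - ‖z.2 - x₀‖) (Real.sqrt (t₀ + R ^ 2 - z.1)) with hd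
  set Φ : ℝ × E → ℝ := fun z => d z * Real.sqrt (gradSq u z) with hΦ
  have hQc : IsCompact Q := isCompact_Icc.prod (isCompact_closedBall _ _)
  have hz₀Q : (t₀, x₀) ∈ Q := ⟨⟨le_rfl, by nlinarith⟩, mem_closedBall_self hR.le⟩
  have hdc : Continuous d := by
    rw [hd]
    fun_prop
  have hgradc : ContinuousOn (fun z => gradSq u z) U := by
    have hf : ContinuousOn (fderiv ℝ u) U := hu.continuousOn_fderiv_of_isOpen hU (by norm_num)
    have : (fun z => gradSq u z) = fun z => ∑ i, ‖fderiv ℝ u z (0, stdOrthonormalBasis ℝ E i)‖ ^ 2 := by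
      funext z; simp [gradSq]
    rw [this]
    exact continuousOn_finsetSum _ fun i _ => ((hf.clm_apply continuousOn_const).norm.pow 2)
  have hΦc : ContinuousOn Φ Q := hdc.continuousOn.mul ((hgradc.mono hQU).sqrt)
  obtain ⟨z₁, hz₁Q, hmax⟩ := hQc.exists_isMaxOn ⟨_, hz₀Q⟩ hΦc
  -- `Φ` at the centre
  have hdz₀ : d (t₀, x₀) = R := by
    simp only [hd, sub_self, norm_zero, sub_zero, add_sub_cancel_left]
    rw [Real.sqrt_sq hR.le, min_self]
  have hΦz₀ : Φ (t₀, x₀) = R * Real.sqrt (gradSq u (t₀, x₀)) := by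
    simp only [hΦ]
    rw [hdz₀]
  have hΦle : R * Real.sqrt (gradSq u (t₀, x₀)) ≤ Φ z₁ := hΦz₀ ▸ hmax hz₀Q
  have hRHS0 : 0 ≤ 2 * K₀ * (1 + c₁) * M / R := by positivity
  -- trivial case: the maximum is `≤ 0`
  rcases le_or_gt (Φ z₁) 0 with hle0 | hpos
  · have h1 : R * Real.sqrt (gradSq u (t₀, x₀)) ≤ 0 := hΦle.trans hle0
    have h2 : Real.sqrt (gradSq u (t₀, x₀)) ≤ 0 := by
      by_contra h
      push Not at h
      exact absurd h1 (not_le.2 (mul_pos hR h))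
    exact h2.trans hRHS0
  -- the maximum point `z₁ = (t₁, x₁)` and the scale `ρ = d(z₁)/2`
  obtain ⟨t₁, x₁⟩ := z₁
  set d₁ : ℝ := d (t₁, x₁) with hd₁
  set g₁ : ℝ := Real.sqrt (gradSq u (t₁, x₁)) with hg₁
  have hg₁0 : 0 ≤ g₁ := Real.sqrt_nonneg _
  have hΦ₁ : Φ (t₁, x₁) = d₁ * g₁ := rfl
  have hd₁pos : 0 < d₁ := by
    by_contra h
    push Not at h
    have : Φ (t₁, x₁) ≤ 0 := by rw [hΦ₁]; exact mul_nonpos_of_nonpos_of_nonneg h hg₁0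
    exact absurd hpos (not_lt.2 this)
  have ht₁ : t₀ ≤ t₁ ∧ t₁ ≤ t₀ + R ^ 2 := hz₁Q.1
  have hx₁ : ‖x₁ - x₀‖ ≤ R := by
    have := hz₁Q.2; rwa [mem_closedBall, dist_eq_norm] at this
  have hd₁x : d₁ ≤ R - ‖x₁ - x₀‖ := min_le_left _ _
  have hd₁t : d₁ ≤ Real.sqrt (t₀ + R ^ 2 - t₁) := min_le_right _ _
  have hd₁t' : d₁ ^ 2 ≤ t₀ + R ^ 2 - t₁ := by
    calc d₁ ^ 2 ≤ Real.sqrt (t₀ + R ^ 2 - t₁) ^ 2 := pow_le_pow_left₀ hd₁pos.le hd₁t 2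
      _ = t₀ + R ^ 2 - t₁ := Real.sq_sqrt (by linarith)
  have hd₁R : d₁ ≤ R := hd₁x.trans (by linarith [norm_nonneg (x₁ - x₀)])
  set ρ : ℝ := d₁ / 2 with hρ
  have hρ0 : 0 < ρ := by positivity
  have hρ1 : ρ ≤ 1 := by rw [hρ]; linarith
  -- the sub-cylinder at `z₁` of radius `ρ`
  have hsub₁ : Icc (t₁ - δ) (t₁ + ρ ^ 2) ×ˢ closedBall x₁ ρ ⊆ U := by
    refine fun z hz => hsubU ⟨⟨by linarith [hz.1.1], ?_⟩, ?_⟩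
    · have : ρ ^ 2 ≤ d₁ ^ 2 := by rw [hρ]; nlinarith
      linarith [hz.1.2]
    · have h2 := hz.2
      rw [mem_closedBall, dist_eq_norm] at h2 ⊢
      calc ‖z.2 - x₀‖ ≤ ‖z.2 - x₁‖ + ‖x₁ - x₀‖ := norm_sub_le_norm_sub_add_norm_sub _ _ _
        _ ≤ R := by linarith
  have hQ₁ : Icc t₁ (t₁ + ρ ^ 2) ×ˢ closedBall x₁ ρ ⊆ Q := by
    refine fun z hz => ⟨⟨ht₁.1.trans hz.1.1, ?_⟩, ?_⟩
    · have : ρ ^ 2 ≤ d₁ ^ 2 := by rw [hρ]; nlinarith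
      linarith [hz.1.2]
    · have h2 := hz.2
      rw [mem_closedBall, dist_eq_norm] at h2 ⊢
      calc ‖z.2 - x₀‖ ≤ ‖z.2 - x₁‖ + ‖x₁ - x₀‖ := norm_sub_le_norm_sub_add_norm_sub _ _ _
        _ ≤ R := by linarith
  -- on it, `|∇u| ≤ 2 g₁`
  have hG : ∀ z ∈ Icc t₁ (t₁ + ρ ^ 2) ×ˢ closedBall x₁ ρ, Real.sqrt (gradSq u z) ≤ 2 * g₁ := by
    intro z hz
    have hzQ := hQ₁ hz
    have h2 := hz.2
    rw [mem_closedBall, dist_eq_norm] at h2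
    -- `d z ≥ d₁ / 2`
    have hdz : d₁ / 2 ≤ d z := by
      simp only [hd]
      refine le_min ?_ ?_
      · have : ‖z.2 - x₀‖ ≤ ‖z.2 - x₁‖ + ‖x₁ - x₀‖ := norm_sub_le_norm_sub_add_norm_sub _ _ _
        linarith
      · have h3 : (d₁ / 2) ^ 2 ≤ t₀ + R ^ 2 - z.1 := by nlinarith [hz.1.2]
        calc d₁ / 2 = Real.sqrt ((d₁ / 2) ^ 2) := (Real.sqrt_sq (by positivity)).symm
          _ ≤ Real.sqrt (t₀ + R ^ 2 - z.1) := Real.sqrt_le_sqrt h3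
    have hdzpos : 0 < d z := lt_of_lt_of_le (by positivity) hdz
    have hΦz : d z * Real.sqrt (gradSq u z) ≤ d₁ * g₁ := hmax hzQ
    -- divide by `d z`
    rw [← le_div_iff₀' hdzpos] at hΦz
    refine hΦz.trans ?_
    rw [div_le_iff₀ hdzpos]
    nlinarith
  -- the localised bound at `z₁`
  have hloc := hB hU hρ0 hρ1 hδ hc₁ hM (by positivity : (0 : ℝ) ≤ 2 * g₁) hsub₁ hu
    (fun z hz => hineq z (hQ₁ hz)) (fun z hz => hMb z (hQ₁ hz)) hG
  -- `g₁² ≤ 2 s² X g₁ + s² X²` with `X = (1 + c₁) M / ρ`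
  set X : ℝ := (1 + c₁) * M / ρ with hX
  have hX0 : 0 ≤ X := by positivity
  have hsq : g₁ ^ 2 ≤ 2 * s ^ 2 * X * g₁ + s ^ 2 * X ^ 2 := by
    have hg₁sq : g₁ ^ 2 = gradSq u (t₁, x₁) := Real.sq_sqrt (gradSq_nonneg _ _)
    rw [hg₁sq, hs2]
    refine hloc.trans ?_
    -- compare the two right-hand sides after clearing `ρ`
    set q : ℝ := ρ⁻¹ with hq
    have hq1 : 1 ≤ q := by rw [hq]; exact one_le_inv_iff₀.2 ⟨hρ0, hρ1⟩
    have hq0 : 0 ≤ q := zero_le_one.trans hq1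
    have e1 : M / ρ ^ 2 = M * q ^ 2 := by rw [hq, div_eq_mul_inv, inv_pow]
    have e2 : 2 * g₁ / ρ = 2 * g₁ * q := by rw [hq, div_eq_mul_inv]
    have e3 : X = (1 + c₁) * M * q := by rw [hX, hq, div_eq_mul_inv]
    rw [e1, e2, e3]
    have hin := localisation_arith hc₁ hM hg₁0 hq1
    calc C₀ * M * (c₁ * (M + 2 * g₁) + M * q ^ 2 + 2 * g₁ * q)
        = C₀ * (M * (c₁ * (M + 2 * g₁) + M * q ^ 2 + 2 * g₁ * q)) := by ring
      _ ≤ C₀ * (2 * ((1 + c₁) * M * q) * g₁ + ((1 + c₁) * M * q) ^ 2) :=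
          mul_le_mul_of_nonneg_left hin hC₀.le
      _ = 2 * C₀ * ((1 + c₁) * M * q) * g₁ + C₀ * ((1 + c₁) * M * q) ^ 2 := by ring
  have hg₁le : g₁ ≤ K₀ * X := le_of_sq_le_two_mul_add hX0 hs0 hsq
  -- conclusion
  have hΦ₁le : Φ (t₁, x₁) ≤ 2 * K₀ * (1 + c₁) * M := by
    rw [hΦ₁]
    calc d₁ * g₁ ≤ d₁ * (K₀ * X) := mul_le_mul_of_nonneg_left hg₁le hd₁pos.le
      _ = 2 * K₀ * (1 + c₁) * M := by rw [hX, hρ]; field_simp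
  have hfin : R * Real.sqrt (gradSq u (t₀, x₀)) ≤ 2 * K₀ * (1 + c₁) * M := hΦle.trans hΦ₁le
  rw [le_div_iff₀ hR]
  linarith

end Localisation

end Carleman

end Literature.Analysis.FluidPDE
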